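import Literature.AlgebraicGeometry.Resolution.EmbeddedResolutionExcellentSurfacesBoundary
import HarnessLib

/-!
# Chain W5.2 — F6 stage 1, residual `LegalDivisorReduction₃`, PHASE 2: the OLD-BOUNDARY-PERMISSIBLE sequence predicate
# and the F-60♯-shaped CONDITIONAL binder `OldBoundaryResolution₃` (definitions only)

[OURS · L1 W5.2 · res-D-pv-016 AS res-L1-w52-stub-5, LDR₃ hand #1 = closer (2a) of `LegalPhaseTwo₃` (res-L1-w52-idea-1 OWNER RULING O1.3
2026-08-27T11:55:07Z; res-L1-w52-plan-1 RULING R3a (3)–(4) 11:49:54Z, R3c 12:01:13Z).]  NOT statements of the manuscript under review;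
AI-typed, weaker than expert review.  DEFINITIONS ONLY; nothing is asserted.  The Prop `OldBoundaryResolution₃` is an OURS
CONDITIONAL BINDER («F-60♯-shaped»): by res-dag-4's FACT RULING 2026-08-27T12:01:38Z (3) the old-boundary form of
Cossart–Jannsen–Saito's Thm. 1.4 is NOT a Literature fact (its centre clause is our inference from the CONSTRUCTION of the canonical
sequence, Cor. 6.26 + Def. 6.23 (2), not a printed assertion); it is consumed ONLY as an explicit hypothesis
`(hOB : OldBoundaryResolution₃)` of the phase-2 closer (`…DepthFlagLegalPhaseTwo`), labelled CONDITIONAL, and is dischargeable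
later as a kernel corollary of the reserved construction-fact F-72 (res-dag-4 (2)).

WHY THIS SHAPE (res-D-pv-016 DESIGN INPUT 11:37:50Z (1)–(2), seconded by idea-1 11:52:06Z (β2), tri-2 TRIAGE v11 (iii)): the typed
F-60 `CossartJannsenSaito2020EmbeddedSequenceBoundary` is a bare `∃` over `IsBPermissibleSequenceB`, whose per-step location clause
«singular on `X_j` OR on the COMPLETE transform `B_j`» admits centres through order-one points of the weight-two marked ideal (a
closed point of `X_{j+1} ∩ G` on a fresh exceptional `G` of coefficient `0`, off the old components) — not transportable to a
LEGAL flag step.  What the CONSTRUCTION gives when `X` is REGULAR (Hilbert–Samuel function constant, so the history function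
`𝓞` is never reset: `𝓞₀ = 𝓑`, `𝓞_{j+1}` = strict transform; new exceptionals are «new»; centres `D_j ⊆ (X_j)^𝓞_max =
{|𝓞_j| maximal ≥ 1}`) is: EVERY point of every centre lies on the STRICT transform `B^old_j` of the INITIAL boundary.  With the
initial boundary `:= Supp M` (the POSITIVE-coefficient components only, idea-1 O1.3 (2a)) every centre point then carries the
host AND an old component, i.e. order `≥ 2`: legality «L2» is by order, for free (`…DepthFlagLegalPhaseTwo`).

## Content (namespace `…Theorems.DepthLegal`)
* `IsOBPermissibleSequence X B σ X' Bold' B'` — inductive predicate: `IsBPermissibleSequenceB X B σ X' B'` VERBATIM (centre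
  `V(C_j)` regular, `𝓘(closure X_j) ≤ C_j`, CJS-permissible for `X_j` at every point, n.c. with the complete transform `B_j`;
  transforms `closure (τ⁻¹(X_j ∖ V(C_j)))`, `τ⁻¹(B_j ∪ V(C_j))`) + a carried third set `Bold_j` (`Bold₀ = B`,
  `Bold_{j+1} = closure (τ⁻¹(Bold_j ∖ V(C_j)))`) + the per-step clause `∀ x ∈ V(C_j), x ∈ Bold_j` in place of hBsing.
* `IsOBPermissibleSequence.isClosed_boundary`, `.old_subset` (`Bold' ⊆ B'`), `.toB` (it IS an `IsBPermissibleSequenceB`),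
  `.closure_union_subset` (`closure X' ∪ closure Bold' ⊆ σ⁻¹(X ∪ B)`).
* `OldBoundaryResolution₃` — the binder, stated over the data of idea-1's `HostBoundary₃` (regular Cartier host `D` on an integral
  Noetherian regular excellent threefold, snc boundary `B` containing no component of the host): an old-boundary-permissible
  sequence from `(Supp D, B)` ending with `X₁ ∪ B₁` a strict normal crossings divisor and `π⁻¹(Supp D ∪ B) = X₁ ∪ B₁`.

## References (pointers in prose; bib key `CossartJannsenSaito2020` = LNM 2270)
* V. Cossart, U. Jannsen, S. Saito, *Desingularization: Invariants and Strategy*, LNM 2270 (2020): Thm. 1.4 (pp. 5–6), Def. 6.1 (2),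
  Def. 6.8/(6.2), Thm. 6.9 (a), Def. 6.23 (2), Thm. 6.25, Cor. 6.26 (proof, case (E)), Lemma 4.27, Lemma 4.28, (4.3)/(4.6)/(4.7).
-/

-- `Summit.<Summit>.<Sub>.Theorems` with `Sub = Summit` (single-conjunct summit, D-0017)
set_option linter.dupNamespace false

noncomputable section

open CategoryTheory CategoryTheory.Limits AlgebraicGeometry TopologicalSpace IsLocalRing
open Literature.AlgebraicGeometry.Resolution
open Scheme.IdealSheafData

namespace Summit.ResolutionOfSingularities.ResolutionOfSingularities.Theorems.DepthLegal

universe u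

/-- [OURS · L1 W5.2] **Sequence of complete `𝓑`-permissible blow-ups over `X` whose centres lie on the STRICT transform of the
INITIAL boundary** («old-boundary-permissible»; the `𝓞`-permissible sequences of Cossart–Jannsen–Saito's Cor. 6.26 construction with
`𝓞₀ = 𝓑`, Def. 6.23 (2), read for an `X` whose Hilbert–Samuel function never drops — e.g. `X` regular).  Exactly as the tree's
`IsBPermissibleSequenceB X B σ X' B'` (centre `V(C_j)` regular, `𝓘_{X_j} ≤ C_j`, permissible for `X_j` at every point, n.c. with the
complete transform `B_j`; new strict transform `closure (τ⁻¹(X_j ∖ V(C_j)))`, new boundary `τ⁻¹(B_j ∪ V(C_j))`), carrying in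
addition `B^old_j`, the strict transform of the initial boundary (`B^old_0 = B`, `B^old_{j+1} = closure (τ⁻¹(B^old_j ∖ V(C_j)))`),
with the per-step clause «every point (all scheme points) of `V(C_j)` lies on `B^old_j`» in place of «singular on `X_j` or on
`B_j`».  Definition only; `toB` recovers `IsBPermissibleSequenceB`.
[cite: CossartJannsenSaito2020, Cor. 6.26 (proof, case (E)), Def. 6.23 (2), Def. 6.8/(6.2), Def. 6.1 (2)] -/
inductive IsOBPermissibleSequence {Z : Scheme.{u}} (X B : Set Z) :
    ∀ ⦃Z' : Scheme.{u}⦄, (Z' ⟶ Z) → Set Z' → Set Z' → Set Z' → Prop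
  /-- no blow-up yet: `(X, B, B)` is its own transform along `𝟙 Z` -/
  | refl : IsOBPermissibleSequence X B (𝟙 Z) X B B
  /-- one more blow-up `τ : Z'' ⟶ Z'` in a `B'`-permissible centre `V(C)` every point of which lies on the strict transform
  `Bold'` of the initial boundary -/
  | blowup ⦃Z' Z'' : Scheme.{u}⦄ {σ : Z' ⟶ Z} {X' Bold' B' : Set Z'}
      (h : IsOBPermissibleSequence X B σ X' Bold' B') (C : Z'.IdealSheafData) (τ : Z'' ⟶ Z')
      (hτ : IsBlowup τ C) (hreg : Scheme.IsRegular C.subscheme)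
      (hsub : vanishingIdeal ⟨closure X', isClosed_closure⟩ ≤ C)
      (hold : ∀ x ∈ (C.support : Set Z'), x ∈ Bold')
      (hperm : ∀ x ∈ (C.support : Set Z'),
        ((stalkIdeal C x).map (Ideal.Quotient.mk
          (stalkIdeal (vanishingIdeal ⟨closure X', isClosed_closure⟩) x))).IsPermissible)
      (hnc : IsNormalCrossingWith Z' (C.support : Set Z') B') :
      IsOBPermissibleSequence X B (τ ≫ σ) (closure (τ ⁻¹' (X' \ (C.support : Set Z'))))
        (closure (τ ⁻¹' (Bold' \ (C.support : Set Z')))) (τ ⁻¹' (B' ∪ (C.support : Set Z')))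

namespace IsOBPermissibleSequence

variable {Z : Scheme.{u}} {X B : Set Z}

/-- Along the sequence the complete transform of a closed boundary is closed. [folklore] -/
theorem isClosed_boundary {Z' : Scheme.{u}} {σ : Z' ⟶ Z} {X' Bold' B' : Set Z'}
    (h : IsOBPermissibleSequence X B σ X' Bold' B') (hB : IsClosed B) : IsClosed B' := by
  induction h with
  | refl => exact hB
  | @blowup Z' Z'' σ X' Bold' B' h C τ hτ hreg hsub hold hperm hnc ih =>
    exact (ih.union C.support.isClosed).preimage τ.continuous

/-- The strict transform of the initial boundary lies in its complete transform: `B^old_j ⊆ B_j` (closed `B`).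
[cite: CossartJannsenSaito2020, (6.2)] -/
theorem old_subset {Z' : Scheme.{u}} {σ : Z' ⟶ Z} {X' Bold' B' : Set Z'}
    (h : IsOBPermissibleSequence X B σ X' Bold' B') (hB : IsClosed B) : Bold' ⊆ B' := by
  induction h with
  | refl => exact le_rfl
  | @blowup Z' Z'' σ X' Bold' B' h C τ hτ hreg hsub hold hperm hnc ih =>
    refine closure_minimal ?_ (((h.isClosed_boundary hB).union C.support.isClosed).preimage τ.continuous)
    exact (Set.preimage_mono Set.sdiff_subset).trans (Set.preimage_mono (ih.trans Set.subset_union_left))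

/-- An old-boundary-permissible sequence IS a `𝓑`-permissible sequence in the sense of Thm. 6.9 (a)
(`IsBPermissibleSequenceB`): a centre point on `B^old_j` lies on `B_j`. [cite: CossartJannsenSaito2020, Thm. 6.9 (a)] -/
theorem toB {Z' : Scheme.{u}} {σ : Z' ⟶ Z} {X' Bold' B' : Set Z'}
    (h : IsOBPermissibleSequence X B σ X' Bold' B') (hB : IsClosed B) : IsBPermissibleSequenceB X B σ X' B' := by
  induction h with
  | refl => exact IsBPermissibleSequenceB.refl
  | @blowup Z' Z'' σ X' Bold' B' h C τ hτ hreg hsub hold hperm hnc ih =>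
    exact IsBPermissibleSequenceB.blowup ih C τ hτ hreg hsub (fun x hx => Or.inr (h.old_subset hB (hold x hx)))
      hperm hnc

/-- The strict transforms lie over the initial data: `closure X' ∪ closure Bold' ⊆ σ⁻¹(X ∪ B)` (closed `X`, `B`). [folklore] -/
theorem closure_union_subset {Z' : Scheme.{u}} {σ : Z' ⟶ Z} {X' Bold' B' : Set Z'}
    (h : IsOBPermissibleSequence X B σ X' Bold' B') (hX : IsClosed X) (hB : IsClosed B) :
    closure X' ∪ closure Bold' ⊆ σ ⁻¹' (X ∪ B) := by
  induction h with
  | refl =>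
    rw [hX.closure_eq, hB.closure_eq]
    intro x hx; simpa using hx
  | @blowup Z' Z'' σ X' Bold' B' h C τ hτ hreg hsub hold hperm hnc ih =>
    have hcl : IsClosed ((τ ≫ σ) ⁻¹' (X ∪ B)) := (hX.union hB).preimage (τ ≫ σ).continuous
    have key : ∀ S : Set Z', closure S ⊆ σ ⁻¹' (X ∪ B) →
        closure (τ ⁻¹' (S \ (C.support : Set Z'))) ⊆ (τ ≫ σ) ⁻¹' (X ∪ B) := by
      intro S hS
      refine closure_minimal ?_ hcl
      rintro y ⟨hyS, -⟩
      have : σ (τ y) ∈ X ∪ B := hS (subset_closure hyS)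
      simpa [Set.mem_preimage, Scheme.Hom.comp_base] using this
    rw [closure_closure, closure_closure]
    exact Set.union_subset (key X' (Set.subset_union_left.trans ih)) (key Bold' (Set.subset_union_right.trans ih))

end IsOBPermissibleSequence

/-- [OURS · L1 W5.2] **The F-60♯-shaped CONDITIONAL binder `OldBoundaryResolution₃`** — «Cossart–Jannsen–Saito Thm. 1.4 WITH
boundary, for a REGULAR hypersurface of a regular excellent threefold, the centres lying on the strict transform of the initial
boundary», stated over the data of `HostBoundary₃` (idea-1 O1.2): on an integral Noetherian regular excellent threefold `E`, for
an effective Cartier divisor `D` with `V(D)` regular and a strict normal crossings divisor `B ⊆ E` containing no codimension-one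
point of `Supp D` («no irreducible component of `X` is contained in `B`»), there is an old-boundary-permissible sequence
`π : E₁ ⟶ E` from `(Supp D, B)` whose end satisfies «`X₁` regular, `B₁` snc, `X₁ ⋔ B₁`» in the form used downstream — `X₁ ∪ B₁` is
a strict normal crossings divisor (for a hypersurface `X` this is Def. 4.1 with `r = 1`) — and `π⁻¹(Supp D ∪ B) = X₁ ∪ B₁`
(«`B' = π_Z⁻¹(B) ∪ E`»).  STATUS: OURS inference from the CONSTRUCTION of the canonical sequence (Cor. 6.26 proof, case (E): iterated
`Σ^{𝓞,max}`-eliminations from `𝓞 := 𝓑`, Def. 6.23 (2); `X` regular ⇒ `H_X` constant ⇒ `𝓞` never reset, Lemma 4.28; end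
`𝓞`-regular ⇒ n.c., Lemma 4.27) — NOT a Literature fact (res-dag-4 FACT RULING 12:01:38Z (3)); consumed only as a hypothesis;
dischargeable as a kernel corollary of the reserved construction-fact F-72.  NOT a statement of the manuscript under review.
[conjecture] [cite: CossartJannsenSaito2020, Thm. 1.4 (pp. 5–6), Cor. 6.26 (proof, case (E)), Def. 6.23 (2), Def. 6.1 (2),
Lemma 4.27, Lemma 4.28] -/
def OldBoundaryResolution₃ : Prop :=
  ∀ (E : Scheme.{u}) [IsIntegral E] [IsNoetherian E], Scheme.IsRegular E → Scheme.IsExcellent E →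
    topologicalKrullDim E = 3 →
    ∀ (D : E.IdealSheafData) (B : Set E), IsEffectiveCartier D → Scheme.IsRegular D.subscheme →
      IsStrictNormalCrossingsDivisor E B → (∀ x ∈ D.support, x ∈ B → 1 < Order.coheight x) →
      ∃ (E₁ : Scheme.{u}) (π : E₁ ⟶ E) (X₁ Bold₁ B₁ : Set E₁),
        IsOBPermissibleSequence (D.support : Set E) B π X₁ Bold₁ B₁ ∧
        IsStrictNormalCrossingsDivisor E₁ (X₁ ∪ B₁) ∧ π ⁻¹' ((D.support : Set E) ∪ B) = X₁ ∪ B₁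

end Summit.ResolutionOfSingularities.ResolutionOfSingularities.Theorems.DepthLegal

end
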